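import Literature.AnabelianGeometry.EtaleTheta.Discharge.Sec2CuspOrbits
import Literature.AnabelianGeometry.EtaleTheta.Discharge.Sec2AutKQuotients

/-!
# [EtTh] Remark 2.6.1 DISCHARGED (modulo the printed definition of `Δ̄_Θ`): the groups
# `Aut_K(X̲̲) = μ_l × {±1}`, `Aut_K(X̲) = ℤ/lℤ ⋊ {±1}`, `Aut_K(C̲̲) = μ_l`, `Aut_K(C̲) = {1}`
# (proof-only companion of `ThetaCoversTempered.lean`)

Mochizuki, *The Étale Theta Function …* [EtTh], Publ. RIMS 45 (2009), §2, Remark 2.6.1, PRIMS text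
p.40 (printed p.266; locators = PDF pages; bib key `MochizukiEtTh2009`): "Suppose, for simplicity, that
`K` contains a primitive `l`-th root of unity. Then … one computes easily that the groups of `K`-linear
automorphisms 'Aut_K(−)' … are given as follows: `Aut_K(X̲̲^log) = μ_l × {±1}`; `Aut_K(X̲^log) = ℤ/lℤ ⋊ {±1}`;
`Aut_K(C̲̲^log) = μ_l`; `Aut_K(C̲^log) = {1}`" [cite: MochizukiEtTh2009, Rmk 2.6.1 p.40].

Cell abc-iut, layer L2, discharge seat abc-iut-L2-d3, node EtTh:Rmk2.6.1 = the named fact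
`TemperedCoverData.Rmk261` of seat abc-iut-L2-t2's `ThetaCoversTempered.lean` (`Aut_K(Z)` typed as the
normaliser quotient `autK (tp Π_Z) = N_{Π^tp_C}(Π^tp_Z)/Π^tp_Z`). RESULTS over `T : TemperedCoverData l`:

* `PiXuu_eq_sup` — the member `Π_{X̲̲} = S·E` in terms of the construction data of `Π_{C̲̲}` (Def 2.3, an
  existential in the interface; Prop 2.2 (iii));
* `nonempty_autK_tpPiCuu_mulEquiv_of_cyclic` — `Aut_K(C̲̲) ≅ ℤ/lℤ` under `HasMuL` and only the
  cyclicity of `Δ̄_Θ` ("`Δ̄_Θ ≅ (ℤ/lℤ)(1)`", p.35, instance-free form);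
* `nonempty_autK_tpPiCuu_mulEquiv`, `nonempty_autK_tpPiXuu_mulEquiv` — `Aut_K(C̲̲) ≅ ℤ/lℤ`,
  `Aut_K(X̲̲) ≅ ℤ/lℤ × ℤ/2ℤ` under `HasMuL` (`μ_l ⊆ K`, as printed) AND the explicit hypothesis
  `hΘ : ⁅Δ_X, Δ_X⁆ ⊔ Ker = Δ̄_Θ`-preimage — the printed DEFINITION "`Δ_Θ := Im(∧² Δ^ab_X)`" (p.35, §1 p.12),
  which the interface `CoverData` does not record (it only has `[Δ̄_Θ-preimage : Ker] = l`, `Δ̄_Θ` central,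
  `Δ_X/Δ̄_Θ ≅ (ℤ/lℤ)²`, and admits models with `Δ̄_X` abelian or `Δ̄_Θ ≅ (ℤ/3ℤ)²` for which the printed
  remark fails) — FINDING reported to the interface owner; `hΘ` yields both "`Δ̄_Θ ≅ ℤ/lℤ`" and the
  non-degeneracy of the commutator pairing (`Sec2AutKPairing`);
* `rmk261_of` — **`T.Rmk261` from `hΘ` alone** (its `X̲`-clause is the unconditional
  `nonempty_autK_tpPiXu_mulEquiv_dihedralGroup` of `Sec2AutKHoldsXu.lean`, its `C̲`-clause abc-iut-L6-t23's
  `autK_tpPiCu_subsingleton`, `ThetaCoversAutCu.lean`);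
* `natCard_cuspOrbits_tpPiXuu`, `cor29_card_undotted_of` — **Cor 2.9 for the undotted members `X̲̲, C̲, C̲̲`**:
  `#(Aut_K(−)-orbits of cusps) = (l+1)/2`, under `hΘ` and the cusp hypotheses `hC1`, `hC2` of
  `Sec2CuspOrbits.lean` (the dotted members need the §1 structure of `Π^tp_Ċ`, absent from the interface).

No new definition, no named fact; nothing asserts that a `TemperedCoverData` exists; no side is taken on
any disputed claim.
-/

namespace Literature.AnabelianGeometry.EtaleTheta

namespace ThetaCovers

namespace TemperedCoverData

universe u

variable {l : ℕ} (T : TemperedCoverData.{u} l)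

/-! ### The tower members in terms of the construction data of `Π_{C̲̲}` -/

section Data

variable {H' E S : Subgroup T.PiC} {ι : T.PiC}

/-- **`Π_{X̲̲} = Π_{C̲̲} ∩ Π_X = S·E`** (Prop 2.2 (iii): `⟨Π_{X̲̲}, ι̲⟩ ∩ Π_{X̲} = Π_{X̲̲}`).
[cite: MochizukiEtTh2009, Def 2.3 p.38] -/
theorem PiXuu_eq_sup (hH' : T.IsTypeLTorsPm H') (hι : T.IsInversion H' ι) (h2 : ι * ι ∈ T.barKer)
    (hE : T.IsMinusEigen (H' ⊓ T.PiX) H' ι E) (hS : T.IsSplitting S)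
    (hdef : T.PiCuu = (S ⊔ E) ⊔ Subgroup.zpowers ι) : T.PiXuu = S ⊔ E := by
  have hle := T.PiCuu_le_of_data hH' hι hE hS hdef
  have key := T.toCoverDataAx.sup_zpowers_inf_eq hH' rfl hι hE hS h2
  unfold PiXuu
  rw [← key, ← hdef]
  refine le_antisymm (le_inf inf_le_left (le_inf (inf_le_left.trans hle) inf_le_right)) ?_
  exact le_inf inf_le_left (inf_le_right.trans inf_le_right)

end Data

/-! ### Remark 2.6.1, clauses `C̲̲` and `X̲̲` — under `μ_l ⊆ K` and the printed definition of `Δ̄_Θ` -/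

/-- **`Aut_K(C̲̲^log) = μ_l`** (Remark 2.6.1): `N_{Π^tp_C}(Π^tp_{C̲̲})/Π^tp_{C̲̲} ≅ ℤ/lℤ`, under `HasMuL` (`μ_l ⊆ K`)
and the CYCLICITY of `Δ̄_Θ` ("`Δ̄_Θ ≅ (ℤ/lℤ)(1)`", p.35) in the instance-free form `Δ̄_Θ-preimage ⊆ t^ℤ·Ker`
(not a field of the interface). [cite: MochizukiEtTh2009, Rmk 2.6.1 p.40] -/
theorem nonempty_autK_tpPiCuu_mulEquiv_of_cyclic
    (hcyc : ∃ t ∈ T.barTheta, T.barTheta ≤ Subgroup.zpowers t ⊔ T.barKer) (hmu : T.HasMuL) :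
    Nonempty (T.autK (T.tp T.PiCuu) ≃* Multiplicative (ZMod l)) := by
  obtain ⟨H', E, S, ι, hH', hι, h2, hE, hS, hdef⟩ := T.isTypeLTorsThetaPm.out
  have hopen : IsOpen (((S ⊔ E) ⊔ Subgroup.zpowers ι : Subgroup T.PiC) : Set T.PiC) :=
    hdef ▸ T.isOpen_PiCuu'
  rw [hdef]
  set P : Subgroup T.PiC := (S ⊔ E) ⊔ Subgroup.zpowers ι with hP
  obtain ⟨e1⟩ := T.nonempty_autK_tp_mulEquiv hopen
  have hN : Subgroup.normalizer (P : Set T.PiC) = H' :=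
    T.toCoverDataAx.normalizer_sup_zpowers_eq hmu hH' hι hE hS
  have hPle : P ≤ H' := hN ▸ Subgroup.le_normalizer
  haveI : (P.subgroupOf H').Normal :=
    (Subgroup.normal_subgroupOf_iff_le_normalizer hPle).mpr hN.ge
  obtain ⟨e2⟩ := nonempty_quotient_subgroupOf_congr (K := P) hN
  obtain ⟨e3⟩ := T.toCoverDataAx.nonempty_quot_sup_zpowers_mulEquiv_of_cyclic hcyc hH' hι h2 hE hS
  exact ⟨e1.trans (e2.trans e3)⟩

/-- **`Aut_K(C̲̲^log) = μ_l`** (Remark 2.6.1) under `HasMuL` and the printed definition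
`hΘ : [Δ_X, Δ_X]·Ker = Δ̄_Θ`-preimage of `Δ̄_Θ` (which gives the cyclicity). [cite: MochizukiEtTh2009, Rmk 2.6.1 p.40] -/
theorem nonempty_autK_tpPiCuu_mulEquiv (hΘ : ⁅T.DeltaX, T.DeltaX⁆ ⊔ T.barKer = T.barTheta)
    (hmu : T.HasMuL) : Nonempty (T.autK (T.tp T.PiCuu) ≃* Multiplicative (ZMod l)) := by
  obtain ⟨H', E, S, ι, hH', -, -, -, -, -⟩ := T.isTypeLTorsThetaPm.out
  exact T.nonempty_autK_tpPiCuu_mulEquiv_of_cyclic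
    (T.toCoverDataAx.barTheta_cyclic_of_commutator hΘ hH'.inf_isTypeLTors) hmu

/-- **`Aut_K(X̲̲^log) = μ_l × {±1}`** (Remark 2.6.1): `N_{Π^tp_C}(Π^tp_{X̲̲})/Π^tp_{X̲̲} ≅ ℤ/lℤ × ℤ/2ℤ`, under
`HasMuL` (`μ_l ⊆ K`) and `hΘ : [Δ_X, Δ_X]·Ker = Δ̄_Θ`-preimage (printed definition of `Δ̄_Θ`, p.35).
[cite: MochizukiEtTh2009, Rmk 2.6.1 p.40] -/
theorem nonempty_autK_tpPiXuu_mulEquiv (hΘ : ⁅T.DeltaX, T.DeltaX⁆ ⊔ T.barKer = T.barTheta)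
    (hmu : T.HasMuL) :
    Nonempty (T.autK (T.tp T.PiXuu) ≃* Multiplicative (ZMod l) × Multiplicative (ZMod 2)) := by
  obtain ⟨H', E, S, ι, hH', hι, h2, hE, hS, hdef⟩ := T.isTypeLTorsThetaPm.out
  have hXuuOpen : IsOpen (T.PiXuu : Set T.PiC) := T.isOpen_PiCuu'.inter T.isOpen_PiX
  have hopen : IsOpen ((S ⊔ E : Subgroup T.PiC) : Set T.PiC) :=
    T.PiXuu_eq_sup hH' hι h2 hE hS hdef ▸ hXuuOpen
  rw [T.PiXuu_eq_sup hH' hι h2 hE hS hdef]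
  set P : Subgroup T.PiC := (S ⊔ E) ⊔ Subgroup.zpowers ι with hP
  set R : Subgroup T.PiC := S ⊔ E with hR
  obtain ⟨e1⟩ := T.nonempty_autK_tp_mulEquiv hopen
  have hN : Subgroup.normalizer (R : Set T.PiC) = H' :=
    T.toCoverDataAx.normalizer_sup_eigen_eq hΘ hmu hH' hι h2 hE hS
  have hNP : Subgroup.normalizer (P : Set T.PiC) = H' :=
    T.toCoverDataAx.normalizer_sup_zpowers_eq hmu hH' hι hE hS
  have hRle : R ≤ H' := hN ▸ Subgroup.le_normalizer
  have hPle : P ≤ H' := hNP ▸ Subgroup.le_normalizer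
  haveI : (R.subgroupOf H').Normal :=
    (Subgroup.normal_subgroupOf_iff_le_normalizer hRle).mpr hN.ge
  haveI : (P.subgroupOf H').Normal :=
    (Subgroup.normal_subgroupOf_iff_le_normalizer hPle).mpr hNP.ge
  obtain ⟨e2⟩ := nonempty_quotient_subgroupOf_congr (K := R) hN
  obtain ⟨e3⟩ := T.toCoverDataAx.nonempty_quot_sup_eigen_mulEquiv hΘ hH' hι h2 hE hS
  exact ⟨e1.trans (e2.trans e3)⟩

/-! ### Remark 2.6.1 -/

/-- **Remark 2.6.1 DISCHARGED modulo the printed definition of `Δ̄_Θ`**: the named fact `T.Rmk261` of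
`ThetaCoversTempered.lean` — `Aut_K(X̲̲) ≅ ℤ/l × ℤ/2`, `Aut_K(X̲) ≅ D_l`, `Aut_K(C̲̲) ≅ ℤ/l`, `Aut_K(C̲) = 1`
under `μ_l ⊆ K` — follows from `hΘ : [Δ_X, Δ_X]·Ker = Δ̄_Θ`-preimage ("`Δ_Θ := Im(∧² Δ^ab_X)`", p.35;
not a field of the interface). The `X̲`- and `C̲`-clauses hold unconditionally
(`nonempty_autK_tpPiXu_mulEquiv_dihedralGroup`, abc-iut-L6-t23's `autK_tpPiCu_subsingleton`).
[cite: MochizukiEtTh2009, Rmk 2.6.1 p.40] -/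
theorem rmk261_of [NeZero l] (hΘ : ⁅T.DeltaX, T.DeltaX⁆ ⊔ T.barKer = T.barTheta) : T.Rmk261 :=
  fun hmu => ⟨T.nonempty_autK_tpPiXuu_mulEquiv hΘ hmu, T.nonempty_autK_tpPiXu_mulEquiv_dihedralGroup,
    T.nonempty_autK_tpPiCuu_mulEquiv hΘ hmu, T.autK_tpPiCu_subsingleton⟩

/-! ### Corollary 2.9 for the undotted members `X̲̲, C̲, C̲̲` -/

/-- **Cor 2.9 for `X̲̲`**: `#(Aut_K(X̲̲)-orbits of cusps) = (l+1)/2`, under `μ_l ⊆ K`, the printed definition `hΘ`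
of `Δ̄_Θ` (for `N(Π^tp_{X̲̲}) = Π^tp_{C̲}`) and the cusp hypotheses `hC1`, `hC2`.
[cite: MochizukiEtTh2009, Cor 2.9 p.43] -/
theorem natCard_cuspOrbits_tpPiXuu (hΘ : ⁅T.DeltaX, T.DeltaX⁆ ⊔ T.barKer = T.barTheta) (hmu : T.HasMuL)
    (hC1 : T.cuspStabC ⊓ T.tp T.PiX ≤ T.tp T.PiXu) (hC2 : ¬ T.cuspStabC ≤ T.tp T.PiX) :
    Nat.card (T.cuspOrbits (T.tp T.PiXuu)) = (l + 1) / 2 := by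
  obtain ⟨H', E, S, ι, hH', hι, h2, hE, hS, hdef⟩ := T.isTypeLTorsThetaPm.out
  refine T.natCard_cuspOrbits_of_normalizer_eq hC1 hC2 ?_
  have hopen : IsOpen ((T.PiXuu : Subgroup T.PiC) : Set T.PiC) := T.isOpen_PiCuu'.inter T.isOpen_PiX
  rw [T.normalizer_tp_eq_of_isOpen hopen, T.PiXuu_eq_sup hH' hι h2 hE hS hdef,
    T.toCoverDataAx.normalizer_sup_eigen_eq hΘ hmu hH' hι h2 hE hS, T.PiCu_eq hH' hι hE hS hdef]

/-- **Corollary 2.9, undotted members** (`X̲̲, C̲, C̲̲`; the typed `Cor29_card` restricted to them): under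
`μ_l ⊆ K`, `#(Aut_K(−)-orbits of cusps) = #(ℤ/lℤ)^± = (l+1)/2`, modulo the printed definition `hΘ` of `Δ̄_Θ`
and the cusp hypotheses `hC1`, `hC2` (interface under-determination, see `Sec2CuspOrbits.lean`).
[cite: MochizukiEtTh2009, Cor 2.9 p.43] -/
theorem cor29_card_undotted_of (hΘ : ⁅T.DeltaX, T.DeltaX⁆ ⊔ T.barKer = T.barTheta)
    (hC1 : T.cuspStabC ⊓ T.tp T.PiX ≤ T.tp T.PiXu) (hC2 : ¬ T.cuspStabC ≤ T.tp T.PiX) :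
    T.HasMuL → ∀ S ∈ [T.tp T.PiXuu, T.tp T.PiCu, T.tp T.PiCuu],
      Nat.card (T.cuspOrbits S) = (l + 1) / 2 := by
  intro hmu S hS
  simp only [List.mem_cons, List.not_mem_nil, or_false] at hS
  rcases hS with rfl | rfl | rfl
  · exact T.natCard_cuspOrbits_tpPiXuu hΘ hmu hC1 hC2
  · exact T.natCard_cuspOrbits_tpPiCu hC1 hC2
  · exact T.natCard_cuspOrbits_tpPiCuu hmu hC1 hC2

end TemperedCoverData

end ThetaCovers

end Literature.AnabelianGeometry.EtaleTheta
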